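/-
Copyright (c) 2026 the pub-hodgecm-mathlib formalisation cell (harness21).  Prover seat hodgecm-mathlib-K2E3-p27 (g0), HCML Track B «K2-LIT» ∕ h413
(`stmt-HodgeConjecture-24833`), line `K2_E3_EllipticInputs`, unit U12 «Characters», leaf (11-2qs-Id′) «`U(1,1)(L⁺_v)` at the identity» of (11-2-nonsplit) (census
`K2/K2E3-p27/g0/CENSUS-NonsplitTwo.K2E3-p27-g0.md` §3, road (qs2-cls)): THE BY-CLASS DISPATCH AT `N = 2` — every irreducible smooth class of the quasi-split `U(Φ₂)(L⁺_v)` at a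
non-split place is SUPERCUSPIDAL or a CONSTITUENT OF A PRINCIPAL SERIES `i_G(χ)` with `χ` continuous.  The `N = 2` twin of ★ p857077 ∕ ★ `F0P3JacquetEmbeddingDichotomy`.  2026-09-04.
-/
import Literature.NumberTheory.Automorphic.JacquetNonzeroEmbedsNormalizedInd            -- ★ brick A `exists_character_quotient_injective_intertwiningMap_cmPrincipalSeries` (every `N`, organ carrier)
import Summits.HodgeConjecture.HodgeConjecture.Theorems.F0P3bHPrincipalSeriesJHHolds       -- ★ (HC₂) `jacquetVanishing_isSupercuspidal_two` (`r_B(π) = 0 ⇒ π` supercuspidal, `U(Φ₂)(L⁺_v)`, `v` non-split)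
import Summits.HodgeConjecture.HodgeConjecture.Theorems.F0P2pTorusPairsAndVacuity          -- ★ `continuous_of_smoothInd_ne_zero` (a non-zero vector of `i(χ)` forces `χ` continuous; any Borel triple)
import Literature.NumberTheory.Automorphic.IrreducibleClassesConstituents                 -- ★ `IrrClass.isConstituentOf_mk_self`, `IrrClass.IsConstituentOf.of_injective`
import HarnessLib

/-!
# Line `K2_E3_EllipticInputs` (h413), unit U12, leaf (11-2qs-Id′), road (qs2-cls): «CUSPIDAL OR PRINCIPAL» AT `N = 2` — every irreducible smooth class of
# `U(Φ₂)(L⁺_v) = ↥(unitaryGroupOfForm (conjLocal L c v) (cmLocalForm L 2 v))`, `v` non-split, is supercuspidal or a constituent of some `i_G(χ)`, `χ` continuous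

Cell `pub/hodgecm-mathlib` (D-0151), Track B «K2-LIT», crux H413 = `stmt-HodgeConjecture-24833`, route of record `HCCMUnconditional`.  Lane `--supports stmt-HodgeConjecture-24833
--as helper`; THEOREMS ONLY (no `def`, no `instance`, no `notation`, no named-fact hypothesis, no `sorry`); count-neutral.  This is the DISPATCH the by-class tie of the hosted leaf
(11-2qs-Id′) `sig_K2E3CharLocIntNearIdentityQuasiSplitTwo` (PART «RANK», dealer K2E3-plan (g4)) starts with — the `N = 2` twin, on the SAME organ carrier `G₂` that (qs2-ps) (K2E3-p21
(g7), D114) and ★ `cmPrincipalSeries L 2 v` use, of ★ p857077 `K2E3LocalIrrepCuspidalOrPrincipalThree.irrClass_isSupercuspidal_or_isConstituentOf_cmPrincipalSeries_three` and of ★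
`F0P3JacquetEmbeddingDichotomy` (D1∕D2∕D2′ for `Gqs = U(Φ₃)(L⁺_v)`).

THE MATHEMATICS (pure assembly of ★ results; [BernsteinZelevinsky1977, Prop. 1.9 (b), §2.3–§2.5]; [Casselman1995, Thm. 3.2.4, Thm. 5.3.1]; [Rogawski1990, §12.1 pp. 171–172]).
Let `π` be an irreducible smooth representation of `G₂ = U(Φ₂)(L⁺_v)` and `B₂ = T₂ N₂` its Borel subgroup (★ `cmBorelTriple L 2 v`; `T₂ = {d(a, (σa)⁻¹)} ≅ L_w^×`).  EITHER the
Jacquet module `r_B(π) = π_N` is NON-ZERO — then `π ↪ i_G(χ)` for a character `χ` of `T₂` through which a quotient of the normalised Jacquet module factors (★ brick A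
`exists_character_quotient_injective_intertwiningMap_cmPrincipalSeries`, EVERY `N`: Frobenius reciprocity for the normalised induction + finiteness of the Jacquet module of a
finitely generated smooth representation), and `χ` is CONTINUOUS because `i_G(χ)` has a non-zero vector, the image of a non-zero vector of `π` (★ `continuous_of_smoothInd_ne_zero`)
(§1); OR `r_B(π) = 0` — then `π` is SUPERCUSPIDAL by Harish-Chandra's criterion for `U(Φ₂)` at a non-split place (★ (HC₂) `F0P3bHPrincipalSeriesJHHolds.jacquetVanishing_isSupercuspidal_two`,
whose structural input, the Cartan decomposition of `U(σ, Φ₂)(K)` for any isometric involution, is ★ `Two.exists_cartan_of_involution_two`) (§2).  Class level: a class is the class of a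
representative (★ `IrrClass.mk_surjective`) and «`[r]` embeds in `i_G(χ)`» gives «`[r]` is a constituent of `i_G(χ)`» (★ `IrrClass.isConstituentOf_mk_self`, ★ `IsConstituentOf.of_injective`) (§3).

* §0 `isSmooth_cmPrincipalSeries` (every `N`; with ★ `IrrClass.isConstituentOf_iff_eq_mk` it is the irreducible-principal-series glue of the by-class tie).
* §1 **`exists_injective_intertwiningMap_cmPrincipalSeries_two`** (D1₂: non-zero Jacquet module ⇒ `π ↪ i_G(χ)`, `χ` continuous; every finite `v`).
* §2 **`isSupercuspidal_or_exists_injective_intertwiningMap_cmPrincipalSeries_two`** (D2₂, `v` non-split), `…_of_irrClass_two` (D2′₂, class level with a representative).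
* §3 HEAD **`irrClass_isSupercuspidal_or_isConstituentOf_cmPrincipalSeries_two`** — `∀ L v, (∀ w, c • w = w) → ∀ c : IrrClass G₂, c.IsSupercuspidal ∨ ∃ χ : ↥(cmBorelTriple L 2 v).M →* ℂˣ,
  Continuous (χ ·) ∧ c.IsConstituentOf (cmPrincipalSeries L 2 v χ)` (the text proposed for the sub-socket (qs2-cls) of PART «RANK», token for token the `N = 2` twin of ★ p857077's head).

HONEST LABEL: HC_CM is proved only modulo the 7 printed citations (2 remaining named inputs: hLiu418 = stmt-HodgeConjecture-24832, h413 = stmt-HodgeConjecture-24833) until rung 0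
closes; count-neutral helper (classification bookkeeping for the by-class tie of (11-2qs-Id′)); no analytic estimate is proved here.

## References
* [BernsteinZelevinsky1977] I. N. Bernstein, A. V. Zelevinsky, *Induced representations of reductive 𝔭-adic groups. I*, Ann. Sci. ÉNS 10 (1977), Prop. 1.9 (b), §2.3–§2.5.
* [Casselman1995] W. Casselman, *Introduction to the theory of admissible representations of 𝔭-adic reductive groups* (notes, 1995), Thm. 3.2.4 (Frobenius reciprocity),
  Thm. 5.3.1 (supercuspidal ⇔ all Jacquet modules vanish).
* [Rogawski1990] J. D. Rogawski, *Automorphic Representations of Unitary Groups in Three Variables*, Ann. of Math. Stud. 123 (1990), §12.1 pp. 171–172 (principal series and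
  Jacquet modules of the quasi-split unitary groups), §12.2 p. 173.
-/

set_option autoImplicit false
-- the mandated namespace repeats the single-problem summit's segment (`HodgeConjecture.HodgeConjecture`)
set_option linter.dupNamespace false

noncomputable section

open NumberField IsDedekindDomain MeasureTheory
open Literature.NumberTheory Literature.NumberTheory.Automorphic Literature.NumberTheory.Automorphic.UnitaryGroup
open Summit.HodgeConjecture.HodgeConjecture.Cruxes.H413.F0P3bHPrincipalSeriesJHHolds (jacquetVanishing_isSupercuspidal_two)
open scoped Matrix MatrixGroups

namespace Summit.HodgeConjecture.HodgeConjecture.Cruxes.H413.K2E3LocalIrrepCuspidalOrPrincipalTwo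

variable (L : Type) [Field L] [NumberField L] [IsCMField L]

/-! ## §0  `i_G(χ)` is smooth (every `N`) -/

/-- **`i_G(χ)` on `U(Φ_N)(L⁺_v)` is a smooth representation, every `N`** (it is the smooth induction ★ `normalizedInd` = ★ `smoothIndRep`, smooth by ★
`Representation.isSmooth_smoothInd`; the `N = 3` instance is ★ `K2E3CharLocIntIrreduciblePrincipalSeries.isSmooth_cmPrincipalSeries`). [cite: BernsteinZelevinsky1977, §2.3]
[cite: Rogawski1990, §12.1 p. 171] -/
theorem isSmooth_cmPrincipalSeries (N : ℕ) (v : HeightOneSpectrum (𝓞 ↥(maximalRealSubfield L))) (χ : ↥(cmBorelTriple L N v).M →* ℂˣ) :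
    (UnitaryGroup.cmPrincipalSeries L N v χ).IsSmooth := by
  haveI := locallyCompactSpace_cmBorelU L N v
  unfold UnitaryGroup.cmPrincipalSeries UnitaryGroup.principalSeries Representation.normalizedInd
  exact Representation.isSmooth_smoothInd (cmBorelTriple L N v).P
    (Representation.twist ((((Representation.trivial ℂ ↥(cmBorelTriple L N v).M ℂ).twist χ).comp (cmBorelTriple L N v).proj))
      (rootDeltaChar (cmBorelTriple L N v).P))

/-! ## §1  D1₂ — non-zero Jacquet module ⇒ embedding into a principal series with a continuous character -/

set_option maxHeartbeats 2000000 in  -- one carrier crossing: `f x : SmoothInd …` read through `cmPrincipalSeries = normalizedInd = smoothIndRep` (same budget as ★ D1 at `N = 3`)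
/-- **D1₂ — an irreducible smooth representation of `U(Φ₂)(L⁺_v)` with non-zero Jacquet module embeds into a principal series `i_G(χ)` with CONTINUOUS `χ`** (every finite `v`):
★ brick A gives `π ↪ i_G(χ)` for a quotient character `χ` of the normalised Jacquet module; `χ` is continuous because `i_G(χ)` has a non-zero vector (★ `continuous_of_smoothInd_ne_zero`).
[cite: BernsteinZelevinsky1977, Prop. 1.9 (b), §2.3] [cite: Casselman1995, Thm. 3.2.4] [cite: Rogawski1990, §12.1 pp. 171–172] -/
theorem exists_injective_intertwiningMap_cmPrincipalSeries_two (v : HeightOneSpectrum (𝓞 ↥(maximalRealSubfield L)))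
    (r : SmoothIrrep ↥(unitaryGroupOfForm (conjLocal L (IsCMField.complexConj L) v) (cmLocalForm L 2 v)))
    (h : ¬ Subsingleton ((cmBorelTriple L 2 v).restrict r.ρ).Coinvariants) :
    ∃ χ : ↥(cmBorelTriple L 2 v).M →* ℂˣ, Continuous (fun t => ((χ t : ℂˣ) : ℂ)) ∧
      ∃ f : r.ρ.IntertwiningMap (cmPrincipalSeries L 2 v χ), Function.Injective f := by
  have hirr : r.ρ.IsIrreducible := r.isIrreducible
  have hsm : r.ρ.IsSmooth := r.isSmooth
  have hnt : Nontrivial ((cmBorelTriple L 2 v).restrict r.ρ).Coinvariants := not_subsingleton_iff_nontrivial.1 h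
  haveI := locallyCompactSpace_cmBorelU L 2 v
  obtain ⟨χ, -, f, hf⟩ :=
    @exists_character_quotient_injective_intertwiningMap_cmPrincipalSeries L _ _ _ 2 v r.V _ _ r.ρ hirr hsm hnt
  -- continuity: a non-zero vector of `i(χ)` (the image of a non-zero vector of the irreducible `r.ρ`) forces `χ` continuous
  haveI : Nontrivial r.V := Representation.IsIrreducible.nontrivial r.ρ
  have hex := exists_ne (0 : r.V)
  rcases hex with ⟨x, hx⟩
  have hfx : f x ≠ 0 := fun h0 => hx (hf (by rw [h0, map_zero]))
  have hcont := F0P2pTorusPairsAndVacuity.continuous_of_smoothInd_ne_zero (cmBorelTriple L 2 v) χ (f x) hfx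
  exact ⟨χ, hcont, f, hf⟩

/-! ## §2  D2₂ — the dichotomy at a non-split place -/

/-- **D2₂ — dichotomy at a non-split place: an irreducible smooth representation of `U(Φ₂)(L⁺_v)` is supercuspidal, or it embeds into a principal series `i_G(χ)` with `χ`
continuous** — ★ (HC₂) (`r_B(π) = 0 ⇒` supercuspidal, Harish-Chandra ∕ Casselman 5.3.1 for `U(Φ₂)`, `jacquetVanishing_isSupercuspidal_two`) or D1₂.
[cite: Casselman1995, Thm. 5.3.1] [cite: BernsteinZelevinsky1977, §2.5] [cite: Rogawski1990, §12.1 pp. 171–172] -/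
theorem isSupercuspidal_or_exists_injective_intertwiningMap_cmPrincipalSeries_two (v : HeightOneSpectrum (𝓞 ↥(maximalRealSubfield L)))
    (hns : ∀ w : PlacesOver L v, IsCMField.complexConj L • w.1 = w.1)
    (r : SmoothIrrep ↥(unitaryGroupOfForm (conjLocal L (IsCMField.complexConj L) v) (cmLocalForm L 2 v))) :
    (IrrClass.mk r).IsSupercuspidal ∨
      ∃ χ : ↥(cmBorelTriple L 2 v).M →* ℂˣ, Continuous (fun t => ((χ t : ℂˣ) : ℂ)) ∧
        ∃ f : r.ρ.IntertwiningMap (cmPrincipalSeries L 2 v χ), Function.Injective f := by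
  by_cases hsub : Subsingleton ((cmBorelTriple L 2 v).restrict r.ρ).Coinvariants
  · exact Or.inl (jacquetVanishing_isSupercuspidal_two L v hns r hsub)
  · exact Or.inr (exists_injective_intertwiningMap_cmPrincipalSeries_two L v r hsub)

/-- **D2′₂ — class-level dichotomy at a non-split place**: every irreducible class `c` of `U(Φ₂)(L⁺_v)` is supercuspidal, or it is the class of an `r` that embeds into a principal
series `i_G(χ)` with `χ` continuous (D2₂ at a representative, ★ `IrrClass.mk_surjective`). [cite: Casselman1995, Thm. 5.3.1] [cite: BernsteinZelevinsky1977, §2.5] -/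
theorem isSupercuspidal_or_exists_injective_intertwiningMap_cmPrincipalSeries_of_irrClass_two (v : HeightOneSpectrum (𝓞 ↥(maximalRealSubfield L)))
    (hns : ∀ w : PlacesOver L v, IsCMField.complexConj L • w.1 = w.1)
    (c : IrrClass ↥(unitaryGroupOfForm (conjLocal L (IsCMField.complexConj L) v) (cmLocalForm L 2 v))) :
    c.IsSupercuspidal ∨
      ∃ r : SmoothIrrep ↥(unitaryGroupOfForm (conjLocal L (IsCMField.complexConj L) v) (cmLocalForm L 2 v)), IrrClass.mk r = c ∧
        ∃ χ : ↥(cmBorelTriple L 2 v).M →* ℂˣ, Continuous (fun t => ((χ t : ℂˣ) : ℂ)) ∧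
          ∃ f : r.ρ.IntertwiningMap (cmPrincipalSeries L 2 v χ), Function.Injective f := by
  -- (`have` + `rcases`, not `obtain … := term`: the latter generalises the term over the large goal and times out — cf. ★ D2′ at `N = 3`)
  have hc' := IrrClass.mk_surjective c
  rcases hc' with ⟨r, hr⟩
  have hD2 := isSupercuspidal_or_exists_injective_intertwiningMap_cmPrincipalSeries_two L v hns r
  rcases hD2 with h | h
  · left
    rw [← hr]
    exact h
  · exact Or.inr ⟨r, hr, h⟩

/-! ## §3  THE HEAD — «cuspidal or principal» at `N = 2`, class level, constituent currency -/

/-- **«CUSPIDAL OR PRINCIPAL» AT `N = 2`, NON-SPLIT `v`** (the `N = 2` twin of ★ p857077's head, token for token with `3 ↦ 2` and `Gqs L v ↦ U(Φ₂)(L⁺_v)`): every irreducible smooth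
class `c` of `U(Φ₂)(L⁺_v) = ↥(unitaryGroupOfForm (conjLocal L c v) (cmLocalForm L 2 v))` is SUPERCUSPIDAL, or there is a CONTINUOUS character `χ` of the diagonal torus `T₂ =
(cmBorelTriple L 2 v).M` with `c` a constituent of the principal series `cmPrincipalSeries L 2 v χ = i_G(χ)` (indeed a subrepresentation: §2 + ★ `IsConstituentOf.of_injective`).
[cite: BernsteinZelevinsky1977, Prop. 1.9 (b), §2.5] [cite: Casselman1995, Thm. 3.2.4, Thm. 5.3.1] [cite: Rogawski1990, §12.1 pp. 171–172] -/
theorem irrClass_isSupercuspidal_or_isConstituentOf_cmPrincipalSeries_two :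
    ∀ (L : Type) [Field L] [NumberField L] [IsCMField L] (v : HeightOneSpectrum (𝓞 ↥(maximalRealSubfield L))),
      (∀ w : PlacesOver L v, IsCMField.complexConj L • w.1 = w.1) →
      ∀ c : IrrClass ↥(unitaryGroupOfForm (conjLocal L (IsCMField.complexConj L) v) (cmLocalForm L 2 v)), c.IsSupercuspidal ∨
        ∃ χ : ↥(cmBorelTriple L 2 v).M →* ℂˣ, Continuous (fun t => ((χ t : ℂˣ) : ℂ)) ∧ c.IsConstituentOf (cmPrincipalSeries L 2 v χ) := by
  intro L _ _ _ v hns c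
  have hD := isSupercuspidal_or_exists_injective_intertwiningMap_cmPrincipalSeries_of_irrClass_two L v hns c
  rcases hD with h | ⟨r, hr, χ, hχ, f, hf⟩
  · exact Or.inl h
  · refine Or.inr ⟨χ, hχ, ?_⟩
    rw [← hr]
    exact (IrrClass.isConstituentOf_mk_self r).of_injective f hf

end Summit.HodgeConjecture.HodgeConjecture.Cruxes.H413.K2E3LocalIrrepCuspidalOrPrincipalTwo

end
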